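import Mathlib.Analysis.Calculus.LineDeriv.IntegrationByParts
import Mathlib.Analysis.SpecialFunctions.SmoothTransition
import Mathlib.Analysis.Calculus.Deriv.Comp
import Mathlib.Analysis.Calculus.Deriv.Mul
import Mathlib.Analysis.Calculus.ContDiff.RCLike
import Mathlib.MeasureTheory.Function.L2Space
import Mathlib.MeasureTheory.Integral.Bochner.Basic
import Mathlib.Analysis.InnerProductSpace.Basic
import Mathlib.Topology.MetricSpace.ProperSpace
import HarnessLib

/-!
# Cut-off weights on a ball of `ℝ^d` and the almost-skewness of a frame of vector fields

This file realises the hypotheses of the abstract interior estimate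
`Literature.Analysis.OperatorTheory.NelsonInteriorEstimate` (monotone, pointwise bounded, almost
skew weights with geometric defect) in the concrete model "smooth vector fields on a ball of
`ℝ^d = Fin d → ℝ` with Lebesgue measure", by Gaffney's cut-off device and integration by parts:

* `radSq x = ∑ xᵢ²` (a smooth radius: `‖x‖² ≤ radSq x ≤ d ‖x‖²` for the sup norm), the geometric
  radii `cutRad S m = S (1 - 2^{-(m+1)})` (`s_0 = S/2`, `s_m ↑ S`) and the cut-offs
  `cutoff S m = ρ ((s_{m+1} - radSq) / (s_{m+1} - s_m))`, `ρ = Real.smoothTransition`: smooth,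
  `[0, 1]`-valued, `= 1` on `{radSq ≤ s_m}`, `= 0` on `{radSq ≥ s_{m+1}}`, increasing in `m`,
  compactly supported in `{radSq ≤ S}`, with slope `|Dχ_m[v]| ≤ C_ρ |D radSq [v]| 2^{m+2} / S`
  (`norm_fderiv_cutoff_le`, `exists_deriv_smoothTransition_le`);
* `integral_mul_fderiv_vectorField` — **integration by parts along a `C¹` vector field** `W` on
  an open set containing the support of `G`:
  `∫ G · DF[W] = -∫ F · DG[W] - ∫ (div W) F G` (from Mathlib's constant-direction
  `integral_mul_fderiv_eq_neg_fderiv_mul_of_integrable`, coordinate by coordinate);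
* `weightMap hS P hP m : V →ₗ[ℂ] L²(ℝ^d)`, `u ↦ [χ_m · P u]`, for a complex linear
  `P : V → C(ℝ^d)` (the chart expression at a base point of a space `V` of smooth functions on
  a group), with `norm_weightMap_le_succ` (monotone), `exists_norm_weightMap_le` and
  `norm_weightMap_le_envelope` (bounded in the level by the envelope `ξ`, `envelope`),
  `norm_weightMap_le_of_bound` (`‖M_m u‖ ≤ B · envelopeNorm` if `|P u| ≤ B` on `{radSq ≤ 2S}`),
  `inner_weightMap`, `norm_weightMap_eq`, `norm_le_norm_weightFun_zero` (`χ_0 = 1` on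
  `{radSq ≤ S/2}`);
* `exists_skew_const` — **the almost-skewness with geometric defect**: for finitely many vector
  fields `V_p` smooth on the ball `‖x‖ < R₀`, `0 < S < R₀²`, operators `A_p` on `V` and a FAMILY
  `(P_b)` of pull-backs intertwining `A_p` with `D(·)[V_p]` on the ball, there is ONE `D ≥ 0` with
  `|⟪M_m (A_p u), M_m w⟫ + ⟪M_m u, M_m (A_p w)⟫| ≤ D 2^m ‖M_{m+1} u‖ ‖M_m w‖` for all base points
  `b`, levels `m`, `p`, `u`, `w` — the constant depends on the fields, `S` and `ρ` only (it is
  uniform in the base point because the frame in an exponential chart does not depend on it).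

Everything here is proved; the definitions are `radSq`, `cutRad`, `cutoff`, `divV`, `weightFun`,
`weightMap`, `envelope`, `envelopeNorm`.

## References

* M. P. Gaffney, *A special Stokes's theorem for complete Riemannian manifolds*, Ann. of Math. 60
  (1954), 140–145 (not held).
* E. Nelson, *Analytic vectors*, Ann. of Math. 70 (1959), 572–615, §6 [Nelson1959] (not held).
* A. Borel, H. Jacquet, *Automorphic forms and automorphic representations*, Proc. Sympos. Pure
  Math. 33.1 (1979), 4.3 (ii) [BorelJacquetCorvallis1979]: the application (moderate growth of
  Lie derivatives of automorphic forms, `Literature/NumberTheory/Automorphic`).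
-/

open scoped InnerProductSpace ContDiff Topology
open MeasureTheory Set Metric Filter Finset

noncomputable section

namespace Literature.Analysis.OperatorTheory

variable {d : ℕ}

/-! ## 1. The squared radius `q(x) = ∑ xᵢ²` -/

/-- The squared Euclidean radius `q(x) = ∑ᵢ xᵢ²` on `ℝ^d` (a smooth substitute for the sup norm
of `Fin d → ℝ`). [folklore] -/
def radSq (x : Fin d → ℝ) : ℝ := ∑ i, x i ^ 2

/-- `0 ≤ q(x)`. [folklore] -/
theorem radSq_nonneg (x : Fin d → ℝ) : 0 ≤ radSq x := Finset.sum_nonneg fun i _ ↦ sq_nonneg (x i)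

/-- `xᵢ² ≤ q(x)`. [folklore] -/
theorem sq_le_radSq (x : Fin d → ℝ) (i : Fin d) : x i ^ 2 ≤ radSq x :=
  Finset.single_le_sum (f := fun j ↦ x j ^ 2) (fun j _ ↦ sq_nonneg (x j)) (Finset.mem_univ i)

/-- `‖x‖ ≤ √q(x)` (sup norm). [folklore] -/
theorem norm_le_sqrt_radSq (x : Fin d → ℝ) : ‖x‖ ≤ Real.sqrt (radSq x) := by
  refine (pi_norm_le_iff_of_nonneg (Real.sqrt_nonneg _)).2 fun i ↦ ?_
  rw [Real.norm_eq_abs, ← Real.sqrt_sq_eq_abs]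
  exact Real.sqrt_le_sqrt (sq_le_radSq x i)

/-- `‖x‖² ≤ q(x)`. [folklore] -/
theorem norm_sq_le_radSq (x : Fin d → ℝ) : ‖x‖ ^ 2 ≤ radSq x := by
  have h := norm_le_sqrt_radSq x
  have h0 := radSq_nonneg x
  nlinarith [Real.sq_sqrt h0, Real.sqrt_nonneg (radSq x), norm_nonneg x]

/-- `q(x) ≤ d ‖x‖²`. [folklore] -/
theorem radSq_le (x : Fin d → ℝ) : radSq x ≤ d * ‖x‖ ^ 2 := by
  calc radSq x = ∑ i, x i ^ 2 := rfl
    _ ≤ ∑ _i : Fin d, ‖x‖ ^ 2 := Finset.sum_le_sum fun i _ ↦ by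
        rw [← sq_abs]
        exact pow_le_pow_left₀ (abs_nonneg _) (by simpa using norm_le_pi_norm x i) 2
    _ = d * ‖x‖ ^ 2 := by simp

/-- `q` is smooth. [folklore] -/
theorem contDiff_radSq : ContDiff ℝ ∞ (radSq : (Fin d → ℝ) → ℝ) := by
  unfold radSq
  exact ContDiff.sum fun i _ ↦ (contDiff_apply ℝ ℝ i).pow 2

/-- `q` is continuous. [folklore] -/
theorem continuous_radSq : Continuous (radSq : (Fin d → ℝ) → ℝ) := contDiff_radSq.continuous

/-- `{q ≤ S}` lies in the closed ball of radius `√S`. [folklore] -/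
theorem setOf_radSq_le_subset_closedBall (S : ℝ) :
    {x : Fin d → ℝ | radSq x ≤ S} ⊆ closedBall 0 (Real.sqrt S) := by
  intro x hx
  rw [mem_closedBall_zero_iff]
  exact (norm_le_sqrt_radSq x).trans (Real.sqrt_le_sqrt hx)

/-- `{q ≤ S}` is compact. [folklore] -/
theorem isCompact_setOf_radSq_le (S : ℝ) : IsCompact {x : Fin d → ℝ | radSq x ≤ S} :=
  (isCompact_closedBall 0 (Real.sqrt S)).of_isClosed_subset
    (isClosed_le continuous_radSq continuous_const) (setOf_radSq_le_subset_closedBall S)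

/-- `{q ≤ S} ⊆ ball 0 R` when `S < R²`, `0 ≤ R`. [folklore] -/
theorem setOf_radSq_le_subset_ball {S R : ℝ} (hR : 0 ≤ R) (hSR : S < R ^ 2) :
    {x : Fin d → ℝ | radSq x ≤ S} ⊆ ball 0 R := by
  intro x hx
  rw [mem_ball_zero_iff]
  have h1 : ‖x‖ ^ 2 < R ^ 2 := (norm_sq_le_radSq x).trans_lt (lt_of_le_of_lt hx hSR)
  exact (pow_lt_pow_iff_left₀ (norm_nonneg x) hR two_ne_zero).mp h1

/-! ## 2. The geometric radii and the cut-offs -/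

/-- The radii `s_m = S (1 - 2^{-(m+1)})`: `s_0 = S/2`, `s_m ↑ S` geometrically. [folklore] -/
def cutRad (S : ℝ) (m : ℕ) : ℝ := S * (1 - (1 / 2) ^ (m + 1))

/-- `s_{m+1} - s_m = S / 2^{m+2}`. [folklore] -/
theorem cutRad_succ_sub (S : ℝ) (m : ℕ) : cutRad S (m + 1) - cutRad S m = S * (1 / 2) ^ (m + 2) := by
  simp only [cutRad]
  ring

/-- `s_0 = S / 2`. [folklore] -/
theorem cutRad_zero (S : ℝ) : cutRad S 0 = S / 2 := by
  simp only [cutRad]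
  ring

/-- `s_m < S` for `S > 0`. [folklore] -/
theorem cutRad_lt {S : ℝ} (hS : 0 < S) (m : ℕ) : cutRad S m < S := by
  have : (0 : ℝ) < (1 / 2) ^ (m + 1) := by positivity
  simp only [cutRad]
  nlinarith

/-- `S / 2 ≤ s_m` for `S ≥ 0`. [folklore] -/
theorem half_le_cutRad {S : ℝ} (hS : 0 ≤ S) (m : ℕ) : S / 2 ≤ cutRad S m := by
  have h1 : ((1 : ℝ) / 2) ^ (m + 1) ≤ 1 / 2 := by
    calc ((1 : ℝ) / 2) ^ (m + 1) ≤ (1 / 2) ^ 1 :=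
          pow_le_pow_of_le_one (by norm_num) (by norm_num) (by omega)
      _ = 1 / 2 := pow_one _
  simp only [cutRad]
  nlinarith

/-- `s_m < s_{m+1}` for `S > 0`. [folklore] -/
theorem cutRad_lt_succ {S : ℝ} (hS : 0 < S) (m : ℕ) : cutRad S m < cutRad S (m + 1) := by
  have := cutRad_succ_sub S m
  have h2 : (0 : ℝ) < S * (1 / 2) ^ (m + 2) := by positivity
  linarith

/-- **The cut-off of level `m`**: `χ_m(x) = ρ ((s_{m+1} - q(x)) / (s_{m+1} - s_m))` with
`ρ = Real.smoothTransition`; it equals `1` on `{q ≤ s_m}`, vanishes on `{q ≥ s_{m+1}}`, is smooth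
with values in `[0, 1]`, increases with `m`, and its slope is `≲ 2^m / S`. Gaffney 1954;
Nelson 1959, §6. [folklore] -/
def cutoff (S : ℝ) (m : ℕ) (x : Fin d → ℝ) : ℝ :=
  Real.smoothTransition ((cutRad S (m + 1) - radSq x) / (cutRad S (m + 1) - cutRad S m))

/-- `0 ≤ χ_m`. [folklore] -/
theorem cutoff_nonneg (S : ℝ) (m : ℕ) (x : Fin d → ℝ) : 0 ≤ cutoff S m x :=
  Real.smoothTransition.nonneg _

/-- `χ_m ≤ 1`. [folklore] -/
theorem cutoff_le_one (S : ℝ) (m : ℕ) (x : Fin d → ℝ) : cutoff S m x ≤ 1 :=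
  Real.smoothTransition.le_one _

/-- `χ_m = 1` on `{q ≤ s_m}`. [folklore] -/
theorem cutoff_eq_one {S : ℝ} (hS : 0 < S) (m : ℕ) {x : Fin d → ℝ} (hx : radSq x ≤ cutRad S m) :
    cutoff S m x = 1 := by
  refine Real.smoothTransition.one_of_one_le ?_
  rw [le_div_iff₀ (by linarith [cutRad_lt_succ hS m]), one_mul]
  linarith

/-- `χ_m = 0` on `{q ≥ s_{m+1}}`. [folklore] -/
theorem cutoff_eq_zero {S : ℝ} (hS : 0 < S) (m : ℕ) {x : Fin d → ℝ} (hx : cutRad S (m + 1) ≤ radSq x) :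
    cutoff S m x = 0 := by
  refine Real.smoothTransition.zero_of_nonpos ?_
  exact div_nonpos_of_nonpos_of_nonneg (by linarith) (by linarith [cutRad_lt_succ hS m])

/-- `χ_m ≤ χ_{m+1}`. [folklore] -/
theorem cutoff_le_succ {S : ℝ} (hS : 0 < S) (m : ℕ) (x : Fin d → ℝ) :
    cutoff S m x ≤ cutoff S (m + 1) x := by
  by_cases hx : radSq x ≤ cutRad S (m + 1)
  · rw [cutoff_eq_one hS (m + 1) hx]
    exact cutoff_le_one S m x
  · rw [cutoff_eq_zero hS m (le_of_not_ge hx)]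
    exact cutoff_nonneg S (m + 1) x

/-- `χ_m` is smooth. [folklore] -/
theorem contDiff_cutoff (S : ℝ) (m : ℕ) : ContDiff ℝ ∞ (cutoff S m : (Fin d → ℝ) → ℝ) :=
  Real.smoothTransition.contDiff.comp ((contDiff_const.sub contDiff_radSq).div_const _)

/-- `χ_m` is continuous. [folklore] -/
theorem continuous_cutoff (S : ℝ) (m : ℕ) : Continuous (cutoff S m : (Fin d → ℝ) → ℝ) :=
  (contDiff_cutoff S m).continuous

/-- The support of `χ_m` lies in `{q < s_{m+1}}`. [folklore] -/
theorem support_cutoff_subset {S : ℝ} (hS : 0 < S) (m : ℕ) :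
    Function.support (cutoff S m : (Fin d → ℝ) → ℝ) ⊆ {x | radSq x < cutRad S (m + 1)} := by
  intro x hx
  by_contra h
  exact hx (cutoff_eq_zero hS m (le_of_not_gt h))

/-- The topological support of `χ_m` lies in `{q ≤ s_{m+1}}`. [folklore] -/
theorem tsupport_cutoff_subset {S : ℝ} (hS : 0 < S) (m : ℕ) :
    tsupport (cutoff S m : (Fin d → ℝ) → ℝ) ⊆ {x | radSq x ≤ cutRad S (m + 1)} :=
  closure_minimal ((support_cutoff_subset hS m).trans fun x hx ↦ show radSq x ≤ _ from le_of_lt hx)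
    (isClosed_le continuous_radSq continuous_const)

/-- The topological support of `χ_m` lies in `{q ≤ S}`. [folklore] -/
theorem tsupport_cutoff_subset' {S : ℝ} (hS : 0 < S) (m : ℕ) :
    tsupport (cutoff S m : (Fin d → ℝ) → ℝ) ⊆ {x | radSq x ≤ S} :=
  (tsupport_cutoff_subset hS m).trans fun _ hx ↦ le_trans hx (cutRad_lt hS (m + 1)).le

/-- `χ_m` has compact support. [folklore] -/
theorem hasCompactSupport_cutoff {S : ℝ} (hS : 0 < S) (m : ℕ) :
    HasCompactSupport (cutoff S m : (Fin d → ℝ) → ℝ) :=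
  (isCompact_setOf_radSq_le S).of_isClosed_subset (isClosed_tsupport _) (tsupport_cutoff_subset' hS m)

/-- `χ_{m+1} = 1` on the support of `χ_m`. [folklore] -/
theorem cutoff_succ_eq_one_of_ne_zero {S : ℝ} (hS : 0 < S) (m : ℕ) {x : Fin d → ℝ}
    (hx : cutoff S m x ≠ 0) : cutoff S (m + 1) x = 1 :=
  cutoff_eq_one hS (m + 1) (le_of_lt (support_cutoff_subset hS m hx))

/-- **A bound for the slope of `Real.smoothTransition`.** [folklore] -/
theorem exists_deriv_smoothTransition_le : ∃ C : ℝ, 0 ≤ C ∧ ∀ t : ℝ, ‖deriv Real.smoothTransition t‖ ≤ C := by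
  have hc : Continuous (deriv Real.smoothTransition) :=
    (Real.smoothTransition.contDiff (n := 1)).continuous_deriv le_rfl
  -- the derivative vanishes off `[0, 1]`
  have hzero : ∀ t : ℝ, t ∉ Icc (0 : ℝ) 1 → deriv Real.smoothTransition t = 0 := by
    intro t ht
    rw [Set.mem_Icc, not_and_or, not_le, not_le] at ht
    rcases ht with ht | ht
    · have hev : Real.smoothTransition =ᶠ[𝓝 t] fun _ ↦ (0 : ℝ) := by
        filter_upwards [Iio_mem_nhds ht] with s hs
        exact Real.smoothTransition.zero_of_nonpos (le_of_lt hs)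
      rw [hev.deriv_eq, deriv_const]
    · have hev : Real.smoothTransition =ᶠ[𝓝 t] fun _ ↦ (1 : ℝ) := by
        filter_upwards [Ioi_mem_nhds ht] with s hs
        exact Real.smoothTransition.one_of_one_le (le_of_lt hs)
      rw [hev.deriv_eq, deriv_const]
  obtain ⟨C, hC⟩ := isCompact_Icc.exists_bound_of_continuousOn (s := Icc (0 : ℝ) 1) hc.continuousOn
  refine ⟨max C 0, le_max_right _ _, fun t ↦ ?_⟩
  by_cases ht : t ∈ Icc (0 : ℝ) 1
  · exact (hC t ht).trans (le_max_left _ _)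
  · rw [hzero t ht, norm_zero]
    exact le_max_right _ _

/-- **The slope of the cut-offs**: `|Dχ_m(x)[v]| ≤ C_ρ |Dq(x)[v]| · 2^{m+2} / S`. [folklore] -/
theorem norm_fderiv_cutoff_le {S : ℝ} (hS : 0 < S) {C : ℝ} (hC : ∀ t : ℝ, ‖deriv Real.smoothTransition t‖ ≤ C)
    (m : ℕ) (x v : Fin d → ℝ) :
    ‖fderiv ℝ (cutoff S m) x v‖ ≤ C * ‖fderiv ℝ radSq x v‖ / (S * (1 / 2) ^ (m + 2)) := by
  set δ : ℝ := cutRad S (m + 1) - cutRad S m with hδ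
  have hδS : δ = S * (1 / 2) ^ (m + 2) := cutRad_succ_sub S m
  have hδ0 : 0 < δ := by rw [hδS]; positivity
  set arg : (Fin d → ℝ) → ℝ := fun y ↦ (cutRad S (m + 1) - radSq y) / δ with harg
  have harg_d : HasFDerivAt arg ((1 / δ) • (-(fderiv ℝ radSq x))) x := by
    have h1 : HasFDerivAt (fun y ↦ cutRad S (m + 1) - radSq y) (-(fderiv ℝ radSq x)) x := by
      simpa using ((contDiff_radSq.differentiable (by simp) x).hasFDerivAt).const_sub (cutRad S (m + 1))
    have h2 := h1.const_smul (1 / δ)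
    refine h2.congr_of_eventuallyEq (Eventually.of_forall fun y ↦ ?_)
    simp only [harg, Pi.smul_apply, smul_eq_mul]
    ring
  have hρ : HasDerivAt Real.smoothTransition (deriv Real.smoothTransition (arg x)) (arg x) :=
    ((Real.smoothTransition.contDiff (n := 1)).differentiable (by simp) _).hasDerivAt
  have hcomp : HasFDerivAt (cutoff S m) (deriv Real.smoothTransition (arg x) • ((1 / δ) • (-(fderiv ℝ radSq x)))) x :=
    hρ.comp_hasFDerivAt x harg_d
  rw [hcomp.fderiv, ← hδS]
  change ‖deriv Real.smoothTransition (arg x) * (1 / δ * -(fderiv ℝ radSq x v))‖ ≤ _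
  rw [norm_mul, norm_mul, norm_neg, norm_div, norm_one, Real.norm_of_nonneg hδ0.le]
  have := hC (arg x)
  have h0 : 0 ≤ ‖fderiv ℝ radSq x v‖ := norm_nonneg _
  calc ‖deriv Real.smoothTransition (arg x)‖ * (1 / δ * ‖(fderiv ℝ radSq x) v‖)
      = ‖deriv Real.smoothTransition (arg x)‖ * ‖(fderiv ℝ radSq x) v‖ / δ := by ring
    _ ≤ C * ‖(fderiv ℝ radSq x) v‖ / δ :=
        div_le_div_of_nonneg_right (mul_le_mul_of_nonneg_right this h0) hδ0.le


/-! ## 3. Integration by parts along a vector field on `ℝ^d` -/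

/-- The divergence `div W = ∑ᵢ ∂ᵢ Wᵢ` of a vector field on `ℝ^d` (with respect to Lebesgue measure
and the standard coordinates). [folklore] -/
def divV (W : (Fin d → ℝ) → (Fin d → ℝ)) (x : Fin d → ℝ) : ℝ :=
  ∑ i, fderiv ℝ W x (Pi.single i 1) i

/-- `v = ∑ vᵢ eᵢ`. [folklore] -/
theorem eq_sum_smul_single (v : Fin d → ℝ) : v = ∑ i, v i • (Pi.single i 1 : Fin d → ℝ) := by
  conv_lhs => rw [← Finset.univ_sum_single v]
  refine Finset.sum_congr rfl fun i _ ↦ ?_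
  rw [← Pi.single_smul, smul_eq_mul, mul_one]

/-- `Df(x)[v] = ∑ᵢ vᵢ Df(x)[eᵢ]`. [folklore] -/
theorem fderiv_apply_eq_sum {F' : Type*} [NormedAddCommGroup F'] [NormedSpace ℝ F']
    (f : (Fin d → ℝ) → F') (x v : Fin d → ℝ) :
    fderiv ℝ f x v = ∑ i, v i • fderiv ℝ f x (Pi.single i 1) := by
  conv_lhs => rw [eq_sum_smul_single v]
  simp only [map_sum, map_smul]

/-- A product `G · w` with `G` of class `C^n`, supported inside an open set `O`, and `w` of class
`C^n` on `O`, is of class `C^n` on the whole space. [folklore] -/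
theorem ContDiff.mul_of_tsupport_subset {n : WithTop ℕ∞} {O : Set (Fin d → ℝ)} (hO : IsOpen O)
    {G w : (Fin d → ℝ) → ℂ} (hG : ContDiff ℝ n G) (hGO : tsupport G ⊆ O) (hw : ContDiffOn ℝ n w O) :
    ContDiff ℝ n fun x ↦ G x * w x := by
  refine contDiff_iff_contDiffAt.2 fun x ↦ ?_
  by_cases hx : x ∈ O
  · exact hG.contDiffAt.mul (hw.contDiffAt (hO.mem_nhds hx))
  · have hx' : x ∉ tsupport G := fun h ↦ hx (hGO h)
    have hev : (fun y ↦ G y * w y) =ᶠ[𝓝 x] fun _ ↦ 0 := by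
      filter_upwards [notMem_tsupport_iff_eventuallyEq.mp hx'] with y hy
      simp [hy]
    exact contDiffAt_const.congr_of_eventuallyEq hev

/-- Continuity version of `ContDiff.mul_of_tsupport_subset`. [folklore] -/
theorem Continuous.mul_of_tsupport_subset {O : Set (Fin d → ℝ)} (hO : IsOpen O)
    {G w : (Fin d → ℝ) → ℂ} (hG : Continuous G) (hGO : tsupport G ⊆ O) (hw : ContinuousOn w O) :
    Continuous fun x ↦ G x * w x := by
  have h := ContDiff.mul_of_tsupport_subset (n := 0) hO (contDiff_zero.2 hG) hGO (contDiffOn_zero.2 hw)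
  exact contDiff_zero.1 h

/-- The coordinates of a `C^n` vector field are `C^n` (as complex-valued functions). [folklore] -/
theorem contDiffOn_coord_ofReal {n : WithTop ℕ∞} {O : Set (Fin d → ℝ)} {W : (Fin d → ℝ) → (Fin d → ℝ)}
    (hW : ContDiffOn ℝ n W O) (i : Fin d) : ContDiffOn ℝ n (fun x ↦ ((W x i : ℝ) : ℂ)) O :=
  Complex.ofRealCLM.contDiff.comp_contDiffOn ((contDiff_apply ℝ ℝ i).comp_contDiffOn hW)

/-- **Integration by parts along a vector field.** For `W` a `C¹` vector field on an open set
`O ⊆ ℝ^d`, `F` a `C¹` function and `G` a `C¹` function with compact support inside `O`,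
`∫ G · DF[W] = - ∫ F · DG[W] - ∫ (div W) F G` (Lebesgue measure). Coordinatewise this is Mathlib's
integration by parts for a constant direction (`integral_mul_fderiv_eq_neg_fderiv_mul_of_integrable`)
applied to `G Wᵢ` and `F`. Gaffney 1954; Nelson 1959, §6. [folklore] -/
theorem integral_mul_fderiv_vectorField {O : Set (Fin d → ℝ)} (hO : IsOpen O)
    {W : (Fin d → ℝ) → (Fin d → ℝ)} (hW : ContDiffOn ℝ 1 W O) {F G : (Fin d → ℝ) → ℂ}
    (hF : ContDiff ℝ 1 F) (hG : ContDiff ℝ 1 G) (hGc : HasCompactSupport G) (hGO : tsupport G ⊆ O) :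
    ∫ x, G x * fderiv ℝ F x (W x) =
      -(∫ x, F x * fderiv ℝ G x (W x)) - ∫ x, (divV W x : ℂ) * (F x * G x) := by
  -- the functions `fᵢ = G · Wᵢ`: `C¹`, compactly supported inside `O`
  set f : Fin d → (Fin d → ℝ) → ℂ := fun i x ↦ G x * ((W x i : ℝ) : ℂ) with hf
  have hfs : ∀ i, ContDiff ℝ 1 (f i) := fun i ↦
    ContDiff.mul_of_tsupport_subset hO hG hGO (contDiffOn_coord_ofReal hW i)
  have hfc : ∀ i, HasCompactSupport (f i) := fun i ↦ by
    have : f i = G * fun x ↦ ((W x i : ℝ) : ℂ) := by funext x; rfl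
    rw [this]
    exact hGc.mul_right
  have hfsupp : ∀ i, tsupport (f i) ⊆ O := fun i ↦ by
    have : f i = G * fun x ↦ ((W x i : ℝ) : ℂ) := by funext x; rfl
    rw [this]
    exact (tsupport_mul_subset_left).trans hGO
  -- continuity of the derivatives
  have hFc : Continuous F := hF.continuous
  have hGc' : Continuous G := hG.continuous
  have hF' : ∀ v, Continuous fun x ↦ fderiv ℝ F x v := fun v ↦
    (hF.continuous_fderiv one_ne_zero).clm_apply continuous_const
  have hG' : ∀ v, Continuous fun x ↦ fderiv ℝ G x v := fun v ↦
    (hG.continuous_fderiv one_ne_zero).clm_apply continuous_const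
  have hf' : ∀ i v, Continuous fun x ↦ fderiv ℝ (f i) x v := fun i v ↦
    ((hfs i).continuous_fderiv one_ne_zero).clm_apply continuous_const
  have hf'c : ∀ i v, HasCompactSupport fun x ↦ fderiv ℝ (f i) x v := fun i v ↦
    ((hfc i).fderiv (𝕜 := ℝ)).comp_left (g := fun L : (Fin d → ℝ) →L[ℝ] ℂ ↦ L v) rfl
  -- (1) the constant-direction integration by parts for each `i`
  have hIBP : ∀ i, ∫ x, f i x * fderiv ℝ F x (Pi.single i 1) =
      -∫ x, fderiv ℝ (f i) x (Pi.single i 1) * F x := by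
    intro i
    refine integral_mul_fderiv_eq_neg_fderiv_mul_of_integrable ?_ ?_ ?_
      (fun x _ ↦ (hfs i).differentiable one_ne_zero x) (fun x _ ↦ hF.differentiable one_ne_zero x)
    · exact ((hf' i _).mul hFc).integrable_of_hasCompactSupport (hf'c i _).mul_right
    · exact (((hfs i).continuous).mul (hF' _)).integrable_of_hasCompactSupport (hfc i).mul_right
    · exact (((hfs i).continuous).mul hFc).integrable_of_hasCompactSupport (hfc i).mul_right
  -- (2) the product rule for `fᵢ`, also off `O` where everything vanishes
  have hprod : ∀ i x, fderiv ℝ (f i) x (Pi.single i 1) =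
      fderiv ℝ G x (Pi.single i 1) * ((W x i : ℝ) : ℂ) +
        G x * ((fderiv ℝ W x (Pi.single i 1) i : ℝ) : ℂ) := by
    intro i x
    by_cases hx : x ∈ O
    · have hWd : DifferentiableAt ℝ W x :=
        (hW.differentiableOn one_ne_zero).differentiableAt (hO.mem_nhds hx)
      have hw : HasFDerivAt (fun y ↦ ((W y i : ℝ) : ℂ))
          ((Complex.ofRealCLM.comp (ContinuousLinearMap.proj i)).comp (fderiv ℝ W x)) x :=
        (Complex.ofRealCLM.comp (ContinuousLinearMap.proj (R := ℝ) (φ := fun _ : Fin d ↦ ℝ) i)).hasFDerivAt.comp x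
          hWd.hasFDerivAt
      have hGd : HasFDerivAt G (fderiv ℝ G x) x := (hG.differentiable one_ne_zero x).hasFDerivAt
      change fderiv ℝ (G * fun y ↦ ((W y i : ℝ) : ℂ)) x (Pi.single i 1) = _
      rw [(hGd.mul hw).fderiv]
      change G x * (((fderiv ℝ W x (Pi.single i 1)) i : ℝ) : ℂ) +
        ((W x i : ℝ) : ℂ) * fderiv ℝ G x (Pi.single i 1) = _
      ring
    · have hx' : x ∉ tsupport G := fun h ↦ hx (hGO h)
      have hG0 : G =ᶠ[𝓝 x] fun _ ↦ 0 := notMem_tsupport_iff_eventuallyEq.mp hx'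
      have hf0 : f i =ᶠ[𝓝 x] fun _ ↦ 0 := by
        filter_upwards [hG0] with y hy
        simp [hf, hy]
      rw [hf0.fderiv_eq, hG0.fderiv_eq]
      simp [hG0.self_of_nhds]
  -- (3) rewrite the left-hand side as a sum over the coordinates
  have hL : ∀ x, G x * fderiv ℝ F x (W x) = ∑ i, f i x * fderiv ℝ F x (Pi.single i 1) := by
    intro x
    rw [fderiv_apply_eq_sum F x (W x), Finset.mul_sum]
    refine Finset.sum_congr rfl fun i _ ↦ ?_
    rw [Complex.real_smul, hf]
    ring
  have hR : ∀ x, F x * fderiv ℝ G x (W x) + (divV W x : ℂ) * (F x * G x) =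
      ∑ i, fderiv ℝ (f i) x (Pi.single i 1) * F x := by
    intro x
    rw [fderiv_apply_eq_sum G x (W x), divV, Complex.ofReal_sum, Finset.mul_sum, Finset.sum_mul,
      ← Finset.sum_add_distrib]
    refine Finset.sum_congr rfl fun i _ ↦ ?_
    rw [hprod i x, Complex.real_smul]
    ring
  -- integrability of the summands
  have hint1 : ∀ i, Integrable fun x ↦ f i x * fderiv ℝ F x (Pi.single i 1) := fun i ↦
    (((hfs i).continuous).mul (hF' _)).integrable_of_hasCompactSupport (hfc i).mul_right
  have hint2 : ∀ i, Integrable fun x ↦ fderiv ℝ (f i) x (Pi.single i 1) * F x := fun i ↦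
    ((hf' i _).mul hFc).integrable_of_hasCompactSupport (hf'c i _).mul_right
  have hintA : Integrable fun x ↦ F x * fderiv ℝ G x (W x) := by
    have hc : Continuous fun x ↦ fderiv ℝ G x (W x) := by
      have e : (fun x ↦ fderiv ℝ G x (W x)) = fun x ↦ ∑ i, (W x i : ℝ) • fderiv ℝ G x (Pi.single i 1) := by
        funext x; exact fderiv_apply_eq_sum G x (W x)
      rw [e]
      refine continuous_finsetSum _ fun i _ ↦ ?_
      have h1 : Continuous fun x ↦ ((W x i : ℝ) : ℂ) * fderiv ℝ G x (Pi.single i 1) := by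
        have h2 : Continuous fun x ↦ fderiv ℝ G x (Pi.single i 1) * ((W x i : ℝ) : ℂ) :=
          Continuous.mul_of_tsupport_subset hO (hG' _)
            ((tsupport_fderiv_apply_subset ℝ (Pi.single i 1)).trans hGO)
            ((contDiffOn_coord_ofReal hW i).continuousOn)
        simpa only [mul_comm] using h2
      simpa only [Complex.real_smul] using h1
    have hsupp : HasCompactSupport fun x ↦ fderiv ℝ G x (W x) := by
      refine HasCompactSupport.of_support_subset_isCompact (hGc.fderiv (𝕜 := ℝ)).isCompact ?_
      intro x hx
      have : fderiv ℝ G x ≠ 0 := fun h0 ↦ hx (by simp [h0])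
      exact subset_closure this
    exact (hFc.mul hc).integrable_of_hasCompactSupport hsupp.mul_left
  have hintB : Integrable fun x ↦ (divV W x : ℂ) * (F x * G x) := by
    have e : (fun x ↦ (divV W x : ℂ) * (F x * G x)) = fun x ↦ (G x * (divV W x : ℂ)) * F x := by
      funext x; ring
    rw [e]
    have hc : Continuous fun x ↦ G x * (divV W x : ℂ) := by
      refine Continuous.mul_of_tsupport_subset hO hGc' hGO ?_
      have : ContinuousOn (fun x ↦ divV W x) O := by
        unfold divV
        refine continuousOn_finsetSum _ fun i _ ↦ ?_
        exact ((continuous_apply i).comp_continuousOn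
          ((hW.continuousOn_fderiv_of_isOpen hO le_rfl).clm_apply continuousOn_const))
      exact Complex.continuous_ofReal.comp_continuousOn this
    exact (hc.mul hFc).integrable_of_hasCompactSupport (hGc.mul_right).mul_right
  -- assemble
  calc ∫ x, G x * fderiv ℝ F x (W x) = ∫ x, ∑ i, f i x * fderiv ℝ F x (Pi.single i 1) :=
        integral_congr_ae (Eventually.of_forall hL)
    _ = ∑ i, ∫ x, f i x * fderiv ℝ F x (Pi.single i 1) := integral_finsetSum _ fun i _ ↦ hint1 i
    _ = ∑ i, -∫ x, fderiv ℝ (f i) x (Pi.single i 1) * F x := Finset.sum_congr rfl fun i _ ↦ hIBP i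
    _ = -∫ x, ∑ i, fderiv ℝ (f i) x (Pi.single i 1) * F x := by
        rw [integral_finsetSum _ fun i _ ↦ hint2 i, Finset.sum_neg_distrib]
    _ = -(∫ x, (F x * fderiv ℝ G x (W x) + (divV W x : ℂ) * (F x * G x))) :=
        by rw [integral_congr_ae (Eventually.of_forall hR)]
    _ = _ := by rw [integral_add hintA hintB, neg_add']


/-! ## 4. The cut-off weights into `L²` -/

section Weights

/-- The weighted function `χ_m · F`. [folklore] -/
def weightFun (S : ℝ) (m : ℕ) (F : (Fin d → ℝ) → ℂ) (x : Fin d → ℝ) : ℂ := (cutoff S m x : ℂ) * F x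

/-- `‖χ_m F (x)‖ = χ_m(x) ‖F x‖`. [folklore] -/
theorem norm_weightFun (S : ℝ) (m : ℕ) (F : (Fin d → ℝ) → ℂ) (x : Fin d → ℝ) :
    ‖weightFun S m F x‖ = cutoff S m x * ‖F x‖ := by
  rw [weightFun, norm_mul, Complex.norm_real, Real.norm_of_nonneg (cutoff_nonneg S m x)]

/-- `χ_m F` is continuous for continuous `F`. [folklore] -/
theorem continuous_weightFun (S : ℝ) (m : ℕ) {F : (Fin d → ℝ) → ℂ} (hF : Continuous F) :
    Continuous (weightFun S m F) :=
  (Complex.continuous_ofReal.comp (continuous_cutoff S m)).mul hF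

/-- `χ_m F` has compact support. [folklore] -/
theorem hasCompactSupport_weightFun {S : ℝ} (hS : 0 < S) (m : ℕ) (F : (Fin d → ℝ) → ℂ) :
    HasCompactSupport (weightFun S m F) := by
  have h : HasCompactSupport fun x : Fin d → ℝ ↦ ((cutoff S m x : ℝ) : ℂ) :=
    (hasCompactSupport_cutoff hS m).comp_left Complex.ofReal_zero
  exact h.mul_right

/-- `χ_m F ∈ L²` for continuous `F`. [folklore] -/
theorem memLp_weightFun {S : ℝ} (hS : 0 < S) (m : ℕ) {F : (Fin d → ℝ) → ℂ} (hF : Continuous F) :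
    MemLp (weightFun S m F) 2 (volume : Measure (Fin d → ℝ)) :=
  (continuous_weightFun S m hF).memLp_of_hasCompactSupport (hasCompactSupport_weightFun hS m F)

/-- Pointwise monotonicity: `‖χ_m F (x)‖ ≤ ‖χ_{m+1} F (x)‖`. [folklore] -/
theorem norm_weightFun_le_succ {S : ℝ} (hS : 0 < S) (m : ℕ) (F : (Fin d → ℝ) → ℂ) (x : Fin d → ℝ) :
    ‖weightFun S m F x‖ ≤ ‖weightFun S (m + 1) F x‖ := by
  rw [norm_weightFun, norm_weightFun]
  exact mul_le_mul_of_nonneg_right (cutoff_le_succ hS m x) (norm_nonneg _)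

/-- The `L²`-norm of a class as a power of an integral. [folklore] -/
theorem norm_toLp_eq_rpow {f : (Fin d → ℝ) → ℂ} (hf : MemLp f 2 (volume : Measure (Fin d → ℝ))) :
    ‖hf.toLp f‖ = (∫ x, ‖f x‖ ^ (2 : ℝ)) ^ (1 / 2 : ℝ) := by
  rw [Lp.norm_toLp, hf.eLpNorm_eq_integral_rpow_norm two_ne_zero ENNReal.ofNat_ne_top,
    ENNReal.toReal_ofReal (Real.rpow_nonneg (integral_nonneg fun x ↦ by positivity) _)]
  norm_num

variable {V : Type*} [AddCommGroup V] [Module ℂ V]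

/-- **The weight maps** `M_m : V → L²(ℝ^d)`, `u ↦ [χ_m · P u]`, for a complex linear map
`P : V → (ℝ^d → ℂ)` with continuous values (think: `V` a space of smooth functions on a group,
`P u` the expression of `u` in an exponential chart at a base point). Nelson 1959, §6 (with
Gaffney's cut-off). [folklore] -/
def weightMap {S : ℝ} (hS : 0 < S) (P : V →ₗ[ℂ] ((Fin d → ℝ) → ℂ)) (hP : ∀ u, Continuous (P u))
    (m : ℕ) : V →ₗ[ℂ] Lp ℂ 2 (volume : Measure (Fin d → ℝ)) where
  toFun u := (memLp_weightFun hS m (hP u)).toLp _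
  map_add' u w := by
    apply Lp.ext
    filter_upwards [(memLp_weightFun hS m (hP (u + w))).coeFn_toLp,
      (memLp_weightFun hS m (hP u)).coeFn_toLp, (memLp_weightFun hS m (hP w)).coeFn_toLp,
      Lp.coeFn_add ((memLp_weightFun hS m (hP u)).toLp _) ((memLp_weightFun hS m (hP w)).toLp _)]
      with x h1 h2 h3 h4
    rw [h4, Pi.add_apply, h1, h2, h3, map_add]
    simp only [weightFun, Pi.add_apply, mul_add]
  map_smul' c u := by
    apply Lp.ext
    filter_upwards [(memLp_weightFun hS m (hP (c • u))).coeFn_toLp,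
      (memLp_weightFun hS m (hP u)).coeFn_toLp,
      Lp.coeFn_smul c ((memLp_weightFun hS m (hP u)).toLp _)] with x h1 h2 h3
    rw [RingHom.id_apply, h3, Pi.smul_apply, h1, h2, map_smul]
    simp only [weightFun, Pi.smul_apply, smul_eq_mul]
    ring

variable {S : ℝ} (hS : 0 < S) (P : V →ₗ[ℂ] ((Fin d → ℝ) → ℂ)) (hP : ∀ u, Continuous (P u))

/-- `weightMap m u = χ_m · P u` almost everywhere. [folklore] -/
theorem coeFn_weightMap (m : ℕ) (u : V) :
    (weightMap hS P hP m u : (Fin d → ℝ) → ℂ) =ᵐ[volume] weightFun S m (P u) :=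
  (memLp_weightFun hS m (hP u)).coeFn_toLp

/-- The norm of a weight as an integral: `‖M_m u‖ = (∫ χ_m² |P u|²)^{1/2}`. [folklore] -/
theorem norm_weightMap_eq (m : ℕ) (u : V) :
    ‖weightMap hS P hP m u‖ = (∫ x, ‖weightFun S m (P u) x‖ ^ (2 : ℝ)) ^ (1 / 2 : ℝ) :=
  norm_toLp_eq_rpow (memLp_weightFun hS m (hP u))

/-- **Monotonicity of the weights**: `‖M_m u‖ ≤ ‖M_{m+1} u‖`. [folklore] -/
theorem norm_weightMap_le_succ (m : ℕ) (u : V) :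
    ‖weightMap hS P hP m u‖ ≤ ‖weightMap hS P hP (m + 1) u‖ := by
  refine Lp.norm_le_norm_of_ae_le ?_
  filter_upwards [coeFn_weightMap hS P hP m u, coeFn_weightMap hS P hP (m + 1) u] with x h1 h2
  rw [h1, h2]
  exact norm_weightFun_le_succ hS m (P u) x

/-- **Inner products of weights are integrals**: `⟪M_m u, M_m w⟫ = ∫ χ_m² conj(P u) (P w)`.
[folklore] -/
theorem inner_weightMap (m : ℕ) (u w : V) :
    ⟪weightMap hS P hP m u, weightMap hS P hP m w⟫_ℂ =
      ∫ x, ((cutoff S m x : ℝ) : ℂ) ^ 2 * (star (P u x) * P w x) := by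
  change ⟪(memLp_weightFun hS m (hP u)).toLp _, (memLp_weightFun hS m (hP w)).toLp _⟫_ℂ = _
  rw [L2.inner_def]
  refine integral_congr_ae ?_
  filter_upwards [(memLp_weightFun hS m (hP u)).coeFn_toLp, (memLp_weightFun hS m (hP w)).coeFn_toLp]
    with x h1 h2
  rw [h1, h2, RCLike.inner_apply']
  simp only [weightFun, Complex.star_def, map_mul, Complex.conj_ofReal]
  ring

/-- The envelope `ξ(x) = ρ ((2S - q(x)) / S)`: a continuous compactly supported function equal
to `1` on `{q ≤ S}` which dominates every cut-off. [folklore] -/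
def envelope (S : ℝ) (x : Fin d → ℝ) : ℝ := Real.smoothTransition ((2 * S - radSq x) / S)

omit hS in
/-- `0 ≤ ξ`. [folklore] -/
theorem envelope_nonneg (x : Fin d → ℝ) : 0 ≤ envelope S x := Real.smoothTransition.nonneg _

include hS in
/-- `ξ = 1` on `{q ≤ S}`. [folklore] -/
theorem envelope_eq_one {x : Fin d → ℝ} (hx : radSq x ≤ S) : envelope S x = 1 := by
  refine Real.smoothTransition.one_of_one_le ?_
  rw [le_div_iff₀ hS]
  linarith

include hS in
/-- `ξ = 0` on `{q ≥ 2S}`. [folklore] -/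
theorem envelope_eq_zero {x : Fin d → ℝ} (hx : 2 * S ≤ radSq x) : envelope S x = 0 :=
  Real.smoothTransition.zero_of_nonpos (div_nonpos_of_nonpos_of_nonneg (by linarith) hS.le)

include hS in
/-- `χ_m ≤ ξ`. [folklore] -/
theorem cutoff_le_envelope (m : ℕ) (x : Fin d → ℝ) : cutoff S m x ≤ envelope S x := by
  by_cases hx : radSq x ≤ S
  · rw [envelope_eq_one hS hx]
    exact cutoff_le_one S m x
  · rw [cutoff_eq_zero hS m ((cutRad_lt hS (m + 1)).le.trans (le_of_not_ge hx))]
    exact envelope_nonneg x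

omit hS in
/-- `ξ` is continuous. [folklore] -/
theorem continuous_envelope : Continuous (envelope S : (Fin d → ℝ) → ℝ) :=
  Real.smoothTransition.continuous.comp ((continuous_const.sub continuous_radSq).div_const _)

include hS in
/-- `ξ` has compact support (inside `{q ≤ 2S}`). [folklore] -/
theorem hasCompactSupport_envelope : HasCompactSupport (envelope S : (Fin d → ℝ) → ℝ) := by
  refine (isCompact_setOf_radSq_le (2 * S)).of_isClosed_subset (isClosed_tsupport _) ?_
  refine closure_minimal (fun x hx ↦ ?_) (isClosed_le continuous_radSq continuous_const)
  by_contra h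
  exact hx (envelope_eq_zero hS (le_of_not_ge h))

include hS in
/-- `ξ · F ∈ L²` for continuous `F`. [folklore] -/
theorem memLp_envelope_mul {F : (Fin d → ℝ) → ℂ} (hF : Continuous F) :
    MemLp (fun x ↦ ((envelope S x : ℝ) : ℂ) * F x) 2 (volume : Measure (Fin d → ℝ)) := by
  refine ((Complex.continuous_ofReal.comp continuous_envelope).mul hF).memLp_of_hasCompactSupport ?_
  exact ((hasCompactSupport_envelope hS).comp_left Complex.ofReal_zero).mul_right

/-- **The size constant** `‖[ξ]‖_{L²}` of the envelope. [folklore] -/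
def envelopeNorm {S : ℝ} (hS : 0 < S) : ℝ :=
  ‖(memLp_envelope_mul (d := d) hS (F := fun _ ↦ (1 : ℂ)) continuous_const).toLp _‖

/-- `0 ≤ envelopeNorm`. [folklore] -/
theorem envelopeNorm_nonneg : 0 ≤ envelopeNorm (d := d) hS := norm_nonneg _

/-- **Boundedness of the weights in the level**: `‖M_m u‖ ≤ ‖[ξ · P u]‖` for all `m`. [folklore] -/
theorem norm_weightMap_le_envelope (m : ℕ) (u : V) :
    ‖weightMap hS P hP m u‖ ≤ ‖(memLp_envelope_mul hS (hP u)).toLp _‖ := by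
  refine Lp.norm_le_norm_of_ae_le ?_
  filter_upwards [coeFn_weightMap hS P hP m u, (memLp_envelope_mul hS (hP u)).coeFn_toLp] with x h1 h2
  rw [h1, h2, norm_weightFun, norm_mul, Complex.norm_real, Real.norm_of_nonneg (envelope_nonneg x)]
  exact mul_le_mul_of_nonneg_right (cutoff_le_envelope hS m x) (norm_nonneg _)

/-- Pointwise boundedness in the level. [folklore] -/
theorem exists_norm_weightMap_le (u : V) : ∃ Λ : ℝ, ∀ m, ‖weightMap hS P hP m u‖ ≤ Λ :=
  ⟨_, fun m ↦ norm_weightMap_le_envelope hS P hP m u⟩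

/-- **The size of the weights**: if `|P u| ≤ B` on `{q ≤ 2S}` then `‖M_m u‖ ≤ B · envelopeNorm`.
[folklore] -/
theorem norm_weightMap_le_of_bound (m : ℕ) (u : V) {B : ℝ}
    (h : ∀ x, radSq x ≤ 2 * S → ‖P u x‖ ≤ B) :
    ‖weightMap hS P hP m u‖ ≤ B * envelopeNorm (d := d) hS := by
  refine (norm_weightMap_le_envelope hS P hP m u).trans ?_
  refine Lp.norm_le_mul_norm_of_ae_le_mul ?_
  filter_upwards [(memLp_envelope_mul hS (hP u)).coeFn_toLp,
    (memLp_envelope_mul (d := d) hS (F := fun _ ↦ (1 : ℂ)) continuous_const).coeFn_toLp] with x h1 h2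
  rw [h1, h2, norm_mul, norm_mul, norm_one, mul_one, Complex.norm_real,
    Real.norm_of_nonneg (envelope_nonneg x), mul_comm]
  by_cases hx : radSq x ≤ 2 * S
  · exact mul_le_mul_of_nonneg_right (h x hx) (envelope_nonneg x)
  · rw [envelope_eq_zero hS (le_of_not_ge hx), mul_zero, mul_zero]

include hS in
/-- The weight of level `0` dominates the function on the inner ball `{q ≤ S/2}`:
`χ_0 = 1` there. [folklore] -/
theorem norm_le_norm_weightFun_zero (F : (Fin d → ℝ) → ℂ) {x : Fin d → ℝ} (hx : radSq x ≤ S / 2) :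
    ‖F x‖ ≤ ‖weightFun S 0 F x‖ := by
  rw [norm_weightFun, cutoff_eq_one hS 0 (by rwa [cutRad_zero]), one_mul]

end Weights

/-! ## 5. Almost skewness of a frame of vector fields for the cut-off weights -/

section Skew

variable {κ : Type*} [Fintype κ] {V : Type*} [AddCommGroup V] [Module ℂ V] {β : Type*}

/-- Uniform bounds for finitely many functions continuous on a compact set. [folklore] -/
theorem exists_forall_norm_le_of_continuousOn {K : Set (Fin d → ℝ)} (hK : IsCompact K)
    {F' : Type*} [NormedAddCommGroup F'] (f : κ → (Fin d → ℝ) → F') (hf : ∀ p, ContinuousOn (f p) K) :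
    ∃ B : ℝ, 0 ≤ B ∧ ∀ p, ∀ x ∈ K, ‖f p x‖ ≤ B := by
  classical
  have h : ∀ p, ∃ C, ∀ x ∈ K, ‖f p x‖ ≤ C := fun p ↦ hK.exists_bound_of_continuousOn (hf p)
  choose C hC using h
  refine ⟨∑ p, max (C p) 0, Finset.sum_nonneg fun p _ ↦ le_max_right _ _, fun p x hx ↦ ?_⟩
  exact (hC p x hx).trans ((le_max_left _ _).trans
    (Finset.single_le_sum (f := fun p ↦ max (C p) 0) (fun p _ ↦ le_max_right _ _) (Finset.mem_univ p)))

/-- **Almost skewness of the frame derivatives for the cut-off weights (Gaffney–Nelson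
integration by parts).** Let `(V_p)_{p ∈ κ}` be finitely many vector fields, smooth on the ball
`‖x‖ < R₀` of `ℝ^d`, and `0 < S < R₀²` (so that the cut-offs `χ_m` of all levels are supported in
the ball). Let `V` be a complex vector space with operators `A_p`, and `(P_b)_{b ∈ β}` a family of
complex linear maps `V → C^∞(ℝ^d)` intertwining `A_p` with the derivative along `V_p` on the ball:
`P_b (A_p u) = D(P_b u)[V_p]` there (think: `P_b u (x) = u (b · exp (∑ x_q X_q))`, the expression
of a smooth function `u` on a Lie group in the exponential chart at the base point `b`, and `A_p`
the left-invariant vector field of `X_p`). Then there is ONE constant `D ≥ 0` such that for all base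
points `b`, levels `m`, indices `p` and `u, w ∈ V`,

  `|⟪M_m (A_p u), M_m w⟫ + ⟪M_m u, M_m (A_p w)⟫| ≤ D · 2^m · ‖M_{m+1} u‖ · ‖M_m w‖`,

`M_m = weightMap (P_b)`: the sum is `∫ χ_m² ∂_{V_p}(conj(P_b u) P_b w)`, which after integration
by parts (`integral_mul_fderiv_vectorField`) is bounded through the slope `≲ 2^m / S` of `χ_m`,
the divergence of `V_p`, `χ_{m+1} = 1` on the support of `χ_m`, and Cauchy–Schwarz.
Gaffney 1954; Nelson 1959, §6. [folklore] -/
theorem exists_skew_const (Vf : κ → (Fin d → ℝ) → (Fin d → ℝ)) {R₀ : ℝ} (hR₀ : 0 ≤ R₀)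
    (hVf : ∀ p, ContDiffOn ℝ ∞ (Vf p) (ball 0 R₀)) {S : ℝ} (hS : 0 < S) (hSR : S < R₀ ^ 2)
    (P : β → V →ₗ[ℂ] ((Fin d → ℝ) → ℂ)) (hPs : ∀ b u, ContDiff ℝ ∞ (P b u))
    (Aop : κ → Module.End ℂ V)
    (hPA : ∀ b p u, EqOn (P b (Aop p u)) (fun x ↦ fderiv ℝ (P b u) x (Vf p x)) (ball 0 R₀)) :
    ∃ D : ℝ, 0 ≤ D ∧ ∀ (b : β) (m : ℕ) (p : κ) (u w : V),
      ‖⟪weightMap hS (P b) (fun u ↦ (hPs b u).continuous) m (Aop p u),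
          weightMap hS (P b) (fun u ↦ (hPs b u).continuous) m w⟫_ℂ +
        ⟪weightMap hS (P b) (fun u ↦ (hPs b u).continuous) m u,
          weightMap hS (P b) (fun u ↦ (hPs b u).continuous) m (Aop p w)⟫_ℂ‖ ≤
      D * 2 ^ m * ‖weightMap hS (P b) (fun u ↦ (hPs b u).continuous) (m + 1) u‖ *
        ‖weightMap hS (P b) (fun u ↦ (hPs b u).continuous) m w‖ := by
  classical
  obtain ⟨Cρ, hCρ0, hCρ⟩ := exists_deriv_smoothTransition_le
  set K : Set (Fin d → ℝ) := {x | radSq x ≤ S} with hK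
  have hKc : IsCompact K := isCompact_setOf_radSq_le S
  have hKO : K ⊆ ball 0 R₀ := setOf_radSq_le_subset_ball hR₀ hSR
  have h1top : (1 : WithTop ℕ∞) ≤ ∞ := by exact_mod_cast le_top
  have hVf1 : ∀ p, ContDiffOn ℝ 1 (Vf p) (ball 0 R₀) := fun p ↦ (hVf p).of_le h1top
  -- uniform bounds on `K`
  have hcont1 : ∀ p, ContinuousOn (fun x ↦ fderiv ℝ radSq x (Vf p x)) K := fun p ↦
    (contDiff_radSq.continuous_fderiv (by simp)).continuousOn.clm_apply
      ((hVf p).continuousOn.mono hKO)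
  obtain ⟨B₁, hB₁0, hB₁⟩ := exists_forall_norm_le_of_continuousOn hKc _ hcont1
  have hcont2 : ∀ p, ContinuousOn (fun x ↦ divV (Vf p) x) K := fun p ↦ by
    unfold divV
    refine continuousOn_finsetSum _ fun i _ ↦ ?_
    exact (continuous_apply i).comp_continuousOn
      ((((hVf1 p).continuousOn_fderiv_of_isOpen isOpen_ball le_rfl).mono hKO).clm_apply
        continuousOn_const)
  obtain ⟨B₂, hB₂0, hB₂⟩ := exists_forall_norm_le_of_continuousOn hKc _ hcont2
  set D : ℝ := 8 * Cρ * B₁ / S + B₂ with hD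
  have hD0 : 0 ≤ D := by positivity
  refine ⟨D, hD0, fun b m p u w ↦ ?_⟩
  -- notation
  set hPc : ∀ u, Continuous (P b u) := fun u ↦ (hPs b u).continuous with hPc_def
  set F : (Fin d → ℝ) → ℂ := P b u with hF
  set G : (Fin d → ℝ) → ℂ := P b w with hG
  have hFs : ContDiff ℝ ∞ F := hPs b u
  have hGs : ContDiff ℝ ∞ G := hPs b w
  -- membership in the ball on the support of the cut-off
  have hsuppK : ∀ x, cutoff S m x ≠ 0 → x ∈ K := fun x hx ↦
    le_trans (le_of_lt (support_cutoff_subset hS m hx)) (cutRad_lt hS (m + 1)).le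
  -- `Ψ = conj F · G` and its derivative
  set Ψ : (Fin d → ℝ) → ℂ := fun x ↦ starRingEnd ℂ (F x) * G x with hΨ
  have hΨs : ContDiff ℝ ∞ Ψ := (Complex.conjCLE.contDiff.comp hFs).mul hGs
  have hΨd : ∀ x v, fderiv ℝ Ψ x v =
      starRingEnd ℂ (fderiv ℝ F x v) * G x + starRingEnd ℂ (F x) * fderiv ℝ G x v := by
    intro x v
    have hFd : HasFDerivAt F (fderiv ℝ F x) x := (hFs.differentiable (by simp) x).hasFDerivAt
    have hGd : HasFDerivAt G (fderiv ℝ G x) x := (hGs.differentiable (by simp) x).hasFDerivAt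
    have hcF : HasFDerivAt (fun y ↦ starRingEnd ℂ (F y))
        ((Complex.conjCLE : ℂ →L[ℝ] ℂ).comp (fderiv ℝ F x)) x :=
      (Complex.conjCLE : ℂ →L[ℝ] ℂ).hasFDerivAt.comp x hFd
    change fderiv ℝ ((fun y ↦ starRingEnd ℂ (F y)) * G) x v = _
    rw [(hcF.mul hGd).fderiv]
    change starRingEnd ℂ (F x) * fderiv ℝ G x v + G x * starRingEnd ℂ (fderiv ℝ F x v) = _
    ring
  -- the cut-off squared, as a complex function
  set G₂ : (Fin d → ℝ) → ℂ := fun x ↦ ((cutoff S m x : ℝ) : ℂ) * ((cutoff S m x : ℝ) : ℂ) with hG₂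
  have hgs : ContDiff ℝ ∞ fun x : Fin d → ℝ ↦ ((cutoff S m x : ℝ) : ℂ) :=
    Complex.ofRealCLM.contDiff.comp (contDiff_cutoff S m)
  have hG₂s : ContDiff ℝ ∞ G₂ := hgs.mul hgs
  have hgc : HasCompactSupport fun x : Fin d → ℝ ↦ ((cutoff S m x : ℝ) : ℂ) :=
    (hasCompactSupport_cutoff hS m).comp_left Complex.ofReal_zero
  have hG₂c : HasCompactSupport G₂ := hgc.mul_right
  have hG₂O : tsupport G₂ ⊆ ball 0 R₀ := by
    refine (closure_mono ?_).trans (((tsupport_cutoff_subset' hS m)).trans hKO)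
    intro x hx
    have : cutoff S m x ≠ 0 := fun h0 ↦ hx (by simp [hG₂, h0])
    exact this
  have hG₂d : ∀ x, fderiv ℝ G₂ x (Vf p x) =
      2 * ((cutoff S m x : ℝ) : ℂ) * ((fderiv ℝ (cutoff S m) x (Vf p x) : ℝ) : ℂ) := by
    intro x
    have hg : HasFDerivAt (fun y : Fin d → ℝ ↦ ((cutoff S m y : ℝ) : ℂ))
        (Complex.ofRealCLM.comp (fderiv ℝ (cutoff S m) x)) x :=
      Complex.ofRealCLM.hasFDerivAt.comp x ((contDiff_cutoff S m).differentiable (by simp) x).hasFDerivAt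
    change fderiv ℝ ((fun y : Fin d → ℝ ↦ ((cutoff S m y : ℝ) : ℂ)) *
      fun y : Fin d → ℝ ↦ ((cutoff S m y : ℝ) : ℂ)) x (Vf p x) = _
    rw [(hg.mul hg).fderiv]
    change ((cutoff S m x : ℝ) : ℂ) * ((fderiv ℝ (cutoff S m) x (Vf p x) : ℝ) : ℂ) +
      ((cutoff S m x : ℝ) : ℂ) * ((fderiv ℝ (cutoff S m) x (Vf p x) : ℝ) : ℂ) = _
    ring
  -- (1) the sum of inner products is `∫ G₂ · DΨ[V_p]`
  have hgc2 : HasCompactSupport fun x : Fin d → ℝ ↦ ((cutoff S m x : ℝ) : ℂ) ^ 2 :=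
    hgc.comp_left (g := fun z : ℂ ↦ z ^ 2) (by simp)
  have hint1 : Integrable fun x ↦ ((cutoff S m x : ℝ) : ℂ) ^ 2 * (star (P b (Aop p u) x) * P b w x) :=
    ((hgs.continuous.pow 2).mul ((hPc _).star.mul (hPc _))).integrable_of_hasCompactSupport
      hgc2.mul_right
  have hint2 : Integrable fun x ↦ ((cutoff S m x : ℝ) : ℂ) ^ 2 * (star (P b u x) * P b (Aop p w) x) :=
    ((hgs.continuous.pow 2).mul ((hPc _).star.mul (hPc _))).integrable_of_hasCompactSupport
      hgc2.mul_right
  have hsum : ⟪weightMap hS (P b) hPc m (Aop p u), weightMap hS (P b) hPc m w⟫_ℂ +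
      ⟪weightMap hS (P b) hPc m u, weightMap hS (P b) hPc m (Aop p w)⟫_ℂ =
      ∫ x, G₂ x * fderiv ℝ Ψ x (Vf p x) := by
    rw [inner_weightMap, inner_weightMap, ← integral_add hint1 hint2]
    refine integral_congr_ae (Eventually.of_forall fun x ↦ ?_)
    by_cases hx : cutoff S m x = 0
    · simp [hG₂, hx]
    · have hxO : x ∈ ball 0 R₀ := hKO (hsuppK x hx)
      simp only [hG₂]
      rw [hΨd, hPA b p u hxO, hPA b p w hxO, Complex.star_def]
      ring
  -- (2) integration by parts
  have hIBP := integral_mul_fderiv_vectorField isOpen_ball (hVf1 p) (hΨs.of_le h1top)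
    (hG₂s.of_le h1top) hG₂c hG₂O
  -- (3) pointwise bounds of the two defect terms
  have hslope : ∀ x, cutoff S m x ≠ 0 →
      ‖fderiv ℝ (cutoff S m) x (Vf p x)‖ ≤ Cρ * B₁ * 2 ^ (m + 2) / S := by
    intro x hx
    have hxK : x ∈ K := hsuppK x hx
    have h1 := norm_fderiv_cutoff_le hS hCρ m x (Vf p x)
    have h2 : Cρ * ‖fderiv ℝ radSq x (Vf p x)‖ / (S * (1 / 2) ^ (m + 2)) ≤
        Cρ * B₁ / (S * (1 / 2) ^ (m + 2)) :=
      div_le_div_of_nonneg_right (mul_le_mul_of_nonneg_left (hB₁ p x hxK) hCρ0) (by positivity)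
    have h3 : Cρ * B₁ / (S * (1 / 2) ^ (m + 2)) = Cρ * B₁ * 2 ^ (m + 2) / S := by
      rw [div_pow, one_pow]
      field_simp
    linarith
  have hboundA : ∀ x, ‖Ψ x * fderiv ℝ G₂ x (Vf p x)‖ ≤
      (8 * Cρ * B₁ / S * 2 ^ m) * (‖weightFun S (m + 1) F x‖ * ‖weightFun S m G x‖) := by
    intro x
    by_cases hx : cutoff S m x = 0
    · rw [hG₂d, hx]
      simp only [Complex.ofReal_zero, mul_zero, zero_mul, norm_zero]
      positivity
    · have hχ' : cutoff S (m + 1) x = 1 := cutoff_succ_eq_one_of_ne_zero hS m hx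
      rw [hG₂d, norm_weightFun, norm_weightFun, hχ', one_mul]
      have hs := hslope x hx
      have hχ0 := cutoff_nonneg S m x
      have e1 : ‖Ψ x * (2 * ((cutoff S m x : ℝ) : ℂ) * ((fderiv ℝ (cutoff S m) x (Vf p x) : ℝ) : ℂ))‖ =
          ‖F x‖ * ‖G x‖ * (2 * cutoff S m x * ‖fderiv ℝ (cutoff S m) x (Vf p x)‖) := by
        simp only [hΨ, norm_mul, Complex.norm_real, Real.norm_of_nonneg hχ0, RCLike.norm_conj,
          Complex.norm_ofNat]
      rw [e1]
      have hFG : 0 ≤ ‖F x‖ * ‖G x‖ := mul_nonneg (norm_nonneg _) (norm_nonneg _)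
      have key : 2 * cutoff S m x * ‖fderiv ℝ (cutoff S m) x (Vf p x)‖ ≤
          cutoff S m x * (8 * Cρ * B₁ / S * 2 ^ m) := by
        have : 2 * (Cρ * B₁ * 2 ^ (m + 2) / S) = 8 * Cρ * B₁ / S * 2 ^ m := by ring
        nlinarith [mul_le_mul_of_nonneg_left hs (mul_nonneg zero_le_two hχ0)]
      calc ‖F x‖ * ‖G x‖ * (2 * cutoff S m x * ‖fderiv ℝ (cutoff S m) x (Vf p x)‖)
          ≤ ‖F x‖ * ‖G x‖ * (cutoff S m x * (8 * Cρ * B₁ / S * 2 ^ m)) :=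
            mul_le_mul_of_nonneg_left key hFG
        _ = 8 * Cρ * B₁ / S * 2 ^ m * (‖F x‖ * (cutoff S m x * ‖G x‖)) := by ring
  have hboundB : ∀ x, ‖(divV (Vf p) x : ℂ) * (Ψ x * G₂ x)‖ ≤
      (B₂ * 2 ^ m) * (‖weightFun S (m + 1) F x‖ * ‖weightFun S m G x‖) := by
    intro x
    by_cases hx : cutoff S m x = 0
    · simp only [hG₂, hx, Complex.ofReal_zero, mul_zero, norm_zero]
      positivity
    · have hχ' : cutoff S (m + 1) x = 1 := cutoff_succ_eq_one_of_ne_zero hS m hx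
      have hxK : x ∈ K := hsuppK x hx
      rw [norm_weightFun, norm_weightFun, hχ', one_mul]
      have hχ0 := cutoff_nonneg S m x
      have hχ1 := cutoff_le_one S m x
      have e1 : ‖(divV (Vf p) x : ℂ) * (Ψ x * G₂ x)‖ =
          ‖divV (Vf p) x‖ * (‖F x‖ * ‖G x‖) * (cutoff S m x * cutoff S m x) := by
        rw [norm_mul, norm_mul, hΨ, hG₂]
        simp only [norm_mul, Complex.norm_real, Real.norm_of_nonneg hχ0, RCLike.norm_conj]
        ring
      rw [e1]
      have hb := hB₂ p x hxK
      have hFG : 0 ≤ ‖F x‖ * ‖G x‖ := mul_nonneg (norm_nonneg _) (norm_nonneg _)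
      have h2m : (1 : ℝ) ≤ 2 ^ m := one_le_pow₀ (by norm_num)
      have key : ‖divV (Vf p) x‖ * (cutoff S m x * cutoff S m x) ≤ B₂ * 2 ^ m * cutoff S m x := by
        have h1 : cutoff S m x * cutoff S m x ≤ cutoff S m x := by nlinarith
        calc ‖divV (Vf p) x‖ * (cutoff S m x * cutoff S m x) ≤ B₂ * cutoff S m x :=
              mul_le_mul hb h1 (mul_nonneg hχ0 hχ0) hB₂0
          _ ≤ B₂ * 2 ^ m * cutoff S m x := by
              rw [mul_assoc]
              refine mul_le_mul_of_nonneg_left ?_ hB₂0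
              nlinarith
      calc ‖divV (Vf p) x‖ * (‖F x‖ * ‖G x‖) * (cutoff S m x * cutoff S m x)
          = (‖divV (Vf p) x‖ * (cutoff S m x * cutoff S m x)) * (‖F x‖ * ‖G x‖) := by ring
        _ ≤ (B₂ * 2 ^ m * cutoff S m x) * (‖F x‖ * ‖G x‖) := mul_le_mul_of_nonneg_right key hFG
        _ = B₂ * 2 ^ m * (‖F x‖ * (cutoff S m x * ‖G x‖)) := by ring
  -- (4) the integrable majorant and Cauchy–Schwarz
  have hmajc : Continuous fun x ↦ ‖weightFun S (m + 1) F x‖ * ‖weightFun S m G x‖ :=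
    (continuous_weightFun S (m + 1) (hPc u)).norm.mul (continuous_weightFun S m (hPc w)).norm
  have hmaj : Integrable fun x ↦ ‖weightFun S (m + 1) F x‖ * ‖weightFun S m G x‖ :=
    hmajc.integrable_of_hasCompactSupport ((hasCompactSupport_weightFun hS (m + 1) F).norm.mul_right)
  have hCS : ∫ x, ‖weightFun S (m + 1) F x‖ * ‖weightFun S m G x‖ ≤
      ‖weightMap hS (P b) hPc (m + 1) u‖ * ‖weightMap hS (P b) hPc m w‖ := by
    have h := integral_mul_norm_le_Lp_mul_Lq (μ := (volume : Measure (Fin d → ℝ)))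
      Real.HolderConjugate.two_two
      (by simpa using memLp_weightFun hS (m + 1) (hPc u)) (by simpa using memLp_weightFun hS m (hPc w))
    rw [norm_weightMap_eq, norm_weightMap_eq]
    exact h
  -- (5) assemble
  have hA : ‖∫ x, Ψ x * fderiv ℝ G₂ x (Vf p x)‖ ≤
      (8 * Cρ * B₁ / S * 2 ^ m) * ∫ x, ‖weightFun S (m + 1) F x‖ * ‖weightFun S m G x‖ := by
    rw [← integral_const_mul]
    exact norm_integral_le_of_norm_le (hmaj.const_mul _) (Eventually.of_forall hboundA)
  have hB : ‖∫ x, (divV (Vf p) x : ℂ) * (Ψ x * G₂ x)‖ ≤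
      (B₂ * 2 ^ m) * ∫ x, ‖weightFun S (m + 1) F x‖ * ‖weightFun S m G x‖ := by
    rw [← integral_const_mul]
    exact norm_integral_le_of_norm_le (hmaj.const_mul _) (Eventually.of_forall hboundB)
  have hI0 : 0 ≤ ∫ x, ‖weightFun S (m + 1) F x‖ * ‖weightFun S m G x‖ :=
    integral_nonneg fun x ↦ mul_nonneg (norm_nonneg _) (norm_nonneg _)
  calc _ = ‖∫ x, G₂ x * fderiv ℝ Ψ x (Vf p x)‖ := by rw [hsum]
    _ = ‖-(∫ x, Ψ x * fderiv ℝ G₂ x (Vf p x)) - ∫ x, (divV (Vf p) x : ℂ) * (Ψ x * G₂ x)‖ := by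
        rw [hIBP]
    _ ≤ ‖∫ x, Ψ x * fderiv ℝ G₂ x (Vf p x)‖ + ‖∫ x, (divV (Vf p) x : ℂ) * (Ψ x * G₂ x)‖ := by
        rw [sub_eq_add_neg, ← neg_add, norm_neg]
        exact norm_add_le _ _
    _ ≤ (8 * Cρ * B₁ / S * 2 ^ m + B₂ * 2 ^ m) *
          ∫ x, ‖weightFun S (m + 1) F x‖ * ‖weightFun S m G x‖ := by
        rw [add_mul]
        exact add_le_add hA hB
    _ ≤ (8 * Cρ * B₁ / S * 2 ^ m + B₂ * 2 ^ m) *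
          (‖weightMap hS (P b) hPc (m + 1) u‖ * ‖weightMap hS (P b) hPc m w‖) :=
        mul_le_mul_of_nonneg_left hCS (by positivity)
    _ = _ := by rw [hD]; ring

end Skew

end Literature.Analysis.OperatorTheory
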